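import Literature.NumberTheory.BeurlingPrimes.LiStieltjes
import Literature.NumberTheory.BeurlingPrimes.ComplexPowerDensity
import HarnessLib

/-!
# The template of Broucke–Debruyne–Révész 2023, Theorem 3.2: `F = li + Σ_ω li(x^ω) − Σ_ρ li(x^ρ) + M li(x^δ)`

Topic `Literature/NumberTheory/BeurlingPrimes`, grouping namespace `BDR` (Broucke–Debruyne–Révész 2023, §3).
Everything in this file is PROVED (definitions + theorems).

BDR 2023, proof of Theorem 3.2 (real, simple zeros `ℛ = R` and poles `𝒮 = S`, as vendored in the tree's named fact
`BrouckeDebruyneRevesz2023_thm32`): the template prime-counting function is (Lemma 3.1, (3.1))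

  `F(x) = li(x) + Σ_{ω ∈ S} li(x^ω) − Σ_{ρ ∈ R} li(x^ρ) + M li(x^δ)`,

with BV/BDR's `li(y) = Σ_{n ≥ 1} (log y)ⁿ/(n·n!·ζ(n+1))` (tree: `li`, `LiSeries.lean`), and its "Riemann" companion is

  `G(x) = Σ_{k ≥ 1} F(x^{1/k})/k = Li(x) + Σ_ω Li(x^ω) − Σ_ρ Li(x^ρ) + M Li(x^δ)`  ((3.3)).

Since `li(x^r) = Σ_n rⁿ (log x)ⁿ/(n·n!·ζ(n+1))` and `Li(x^r) = Σ_n rⁿ (log x)ⁿ/(n·n!)` (BDR (2.3)–(2.4)), both are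
log-power series (tree: `logSeries`) with coefficients `liCoeff n · w n`, `LiCoeff n · w n`, where

  `w n = 1 + Σ_{ω ∈ S} ωⁿ − Σ_{ρ ∈ R} ρⁿ + M δⁿ`   (`tmplWeight`).

Main statements:
* `exists_forall_half_le_tmplWeight` — **Lemma 3.1 for real exponents, coefficientwise**: there is `M₀` with
  `w n ≥ 1/2` for all `n ≥ 1`, `M ≥ M₀` (so `F` is increasing; BDR prove Lemma 3.1 for complex multisets via the
  derivative, here the real case is settled on the coefficients: `Σ_ρ ρⁿ ≤ |R| qⁿ ≤ 1/2` for `n ≥ N`, and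
  `M δⁿ ≥ M δ^N ≥ |R|` for `n < N`);
* `F`, `G` and their densities `f = F′`, `g = G′` on `(1, ∞)` (`hasDerivAt_F`, `hasDerivAt_G`), with
  `0 ≤ f ≤ g`, `f ≤ W`, `g ≤ W`, `f ≤ W/log u`, `g − f ≤ W u^{−1/2}` (`W = 1 + |S| + |R| + M`), `F(1) = G(1) = 0`,
  `F` monotone and continuous, `F → ∞`, `F ≤ W·li ≤ 2W x/log x`, `G ≤ W(x − 1)`;
* `g_eq_cpowDensity` — `g(u) = Li′(u) + Σ_ω cpowDensity ω u − Σ_ρ cpowDensity ρ u + M cpowDensity δ u` (`u > 1`), the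
  link to the tree's Mellin transforms `exp ∫₁^∞ cpowDensity z u · u^{−s} du = s/(s − z)` (`ComplexPowerDensity.lean`);
* `hasSum_F_rpow_div` — `Σ_{k ≥ 1} F(x^{1/k})/k = G(x)` (`x ≥ 1`).

## References
* [BrouckeDebruyneRevesz2023] F. Broucke, G. Debruyne, Sz. Gy. Révész, *Some examples of well-behaved Beurling
  number systems*, arXiv:2309.01567, §2 (2.1)–(2.7), Lemma 3.1, proof of Theorem 3.2 ((3.1)–(3.3)) (read, pp. 6–8).
* [BrouckeVindas2024] F. Broucke, J. Vindas, Math. Z. 307 (2024), arXiv:2102.08478, proof of Theorem 3.1 (`li`).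
-/

noncomputable section

open Complex Set Filter MeasureTheory Real
open scoped Topology Nat

namespace Literature.NumberTheory.BeurlingPrimes

namespace BDR

variable (R S : Finset ℝ) (δ : ℝ) (M : ℕ)

/-! ### The weights `w n = 1 + Σ_ω ωⁿ − Σ_ρ ρⁿ + M δⁿ` and Lemma 3.1 -/

/-- The weight of `(log x)ⁿ/(n·n!·ζ(n+1))` in `F`: `w n = 1 + Σ_{ω∈S} ωⁿ − Σ_{ρ∈R} ρⁿ + M δⁿ`.
[cite: BrouckeDebruyneRevesz2023, Lemma 3.1 (3.1)] -/
def tmplWeight (n : ℕ) : ℝ :=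
  1 + ∑ ω ∈ S, ω ^ n - ∑ ρ ∈ R, ρ ^ n + M * δ ^ n

/-- The size parameter `W = 1 + |S| + |R| + M`. [cite: BrouckeDebruyneRevesz2023, proof of Theorem 3.2] -/
def wBound : ℝ := 1 + S.card + R.card + M

variable {R S δ M}

/-- `1 ≤ W`. [folklore] -/
theorem one_le_wBound : 1 ≤ wBound R S M := by
  unfold wBound
  have h1 : (0 : ℝ) ≤ S.card := Nat.cast_nonneg _
  have h2 : (0 : ℝ) ≤ R.card := Nat.cast_nonneg _
  have h3 : (0 : ℝ) ≤ M := Nat.cast_nonneg _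
  linarith

/-- `0 < W`. [folklore] -/
theorem wBound_pos : 0 < wBound R S M := lt_of_lt_of_le one_pos one_le_wBound

/-- A sum of `n`-th powers of numbers in `[0,1]` is between `0` and the number of terms. [folklore] -/
theorem sum_pow_mem {T : Finset ℝ} (hT : ∀ r ∈ T, 0 ≤ r ∧ r ≤ 1) (n : ℕ) :
    0 ≤ ∑ r ∈ T, r ^ n ∧ ∑ r ∈ T, r ^ n ≤ T.card := by
  refine ⟨Finset.sum_nonneg fun r hr ↦ pow_nonneg (hT r hr).1 n, ?_⟩
  have h := Finset.sum_le_card_nsmul T (fun r ↦ r ^ n) 1 fun r hr ↦ pow_le_one₀ (hT r hr).1 (hT r hr).2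
  simpa using h

/-- `|w n| ≤ W` when all exponents lie in `[0, 1]`. [cite: BrouckeDebruyneRevesz2023, Lemma 3.1] -/
theorem abs_tmplWeight_le (hR : ∀ ρ ∈ R, 0 ≤ ρ ∧ ρ ≤ 1) (hS : ∀ ω ∈ S, 0 ≤ ω ∧ ω ≤ 1) (hδ0 : 0 ≤ δ) (hδ1 : δ ≤ 1)
    (n : ℕ) : |tmplWeight R S δ M n| ≤ wBound R S M := by
  obtain ⟨hS0, hS1⟩ := sum_pow_mem hS n
  obtain ⟨hR0, hR1⟩ := sum_pow_mem hR n
  have hd0 : 0 ≤ (M : ℝ) * δ ^ n := by positivity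
  have hd1 : (M : ℝ) * δ ^ n ≤ M := by
    have := pow_le_one₀ hδ0 hδ1 (n := n)
    have hM : (0 : ℝ) ≤ M := Nat.cast_nonneg M
    nlinarith
  unfold tmplWeight wBound
  rw [abs_le]
  constructor <;> linarith

/-- **Lemma 3.1 (real exponents, coefficientwise).** If `R ⊂ [0, 1)`, `S ⊂ [0, 1]` and `0 < δ ≤ 1`, there is `M₀` such
that `w n ≥ 1/2` for every `n ≥ 1` and every `M ≥ M₀`: with `q = max R < 1` and `N` such that `|R| q^N ≤ 1/2`,
one has `Σ_ρ ρⁿ ≤ 1/2` for `n ≥ N`, while for `n < N` the term `M δⁿ ≥ M₀ δ^N ≥ |R| ≥ Σ_ρ ρⁿ`.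
[cite: BrouckeDebruyneRevesz2023, Lemma 3.1] -/
theorem exists_forall_half_le_tmplWeight (hR : ∀ ρ ∈ R, 0 ≤ ρ ∧ ρ < 1) (hS : ∀ ω ∈ S, 0 ≤ ω ∧ ω ≤ 1)
    (hδ0 : 0 < δ) (hδ1 : δ ≤ 1) :
    ∃ M₀ : ℕ, ∀ M : ℕ, M₀ ≤ M → ∀ n : ℕ, 1 ≤ n → 1 / 2 ≤ tmplWeight R S δ M n := by
  have hS0 : ∀ n, 0 ≤ ∑ ω ∈ S, ω ^ n := fun n ↦ (sum_pow_mem hS n).1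
  rcases R.eq_empty_or_nonempty with hRe | hRne
  · refine ⟨0, fun M _ n _ ↦ ?_⟩
    have := hS0 n
    have hd : 0 ≤ (M : ℝ) * δ ^ n := by positivity
    rw [tmplWeight, hRe, Finset.sum_empty]
    linarith
  -- `q = max R`, `0 ≤ q < 1`
  obtain ⟨q, hqR, hqmax⟩ := Finset.exists_max_image R id hRne
  have hq0 : 0 ≤ q := (hR q hqR).1
  have hq1 : q < 1 := (hR q hqR).2
  have hsum_le : ∀ n, ∑ ρ ∈ R, ρ ^ n ≤ R.card * q ^ n := by
    intro n
    have h := Finset.sum_le_card_nsmul R (fun ρ ↦ ρ ^ n) (q ^ n) fun ρ hρ ↦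
      pow_le_pow_left₀ (hR ρ hρ).1 (hqmax ρ hρ) n
    simpa using h
  have hsum_le' : ∀ n, ∑ ρ ∈ R, ρ ^ n ≤ R.card := fun n ↦ (sum_pow_mem (fun ρ hρ ↦ ⟨(hR ρ hρ).1, (hR ρ hρ).2.le⟩) n).2
  -- `N` with `|R| q^N ≤ 1/2`
  have hcard : (0 : ℝ) < R.card := by exact_mod_cast Finset.card_pos.mpr hRne
  obtain ⟨N, hN⟩ : ∃ N : ℕ, (R.card : ℝ) * q ^ N ≤ 1 / 2 := by
    have ht := (tendsto_pow_atTop_nhds_zero_of_lt_one hq0 hq1).const_mul (R.card : ℝ)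
    rw [mul_zero] at ht
    have hev := ht.eventually (Iic_mem_nhds (show (0 : ℝ) < 1 / 2 by norm_num))
    exact hev.exists
  -- `M₀ = ⌈|R|/δ^N⌉`
  refine ⟨⌈(R.card : ℝ) / δ ^ N⌉₊, fun M hM n hn ↦ ?_⟩
  have hδN : 0 < δ ^ N := pow_pos hδ0 N
  have hM' : (R.card : ℝ) / δ ^ N ≤ M := (Nat.le_ceil _).trans (by exact_mod_cast hM)
  have hMδ : (R.card : ℝ) ≤ M * δ ^ N := by rwa [div_le_iff₀ hδN] at hM'
  unfold tmplWeight
  rcases le_or_gt N n with hNn | hnN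
  · -- `n ≥ N`: `Σ ρⁿ ≤ |R| qⁿ ≤ |R| q^N ≤ 1/2`
    have h1 : (R.card : ℝ) * q ^ n ≤ R.card * q ^ N :=
      mul_le_mul_of_nonneg_left (pow_le_pow_of_le_one hq0 hq1.le hNn) hcard.le
    have h2 := hsum_le n
    have h3 := hS0 n
    have h4 : 0 ≤ (M : ℝ) * δ ^ n := by positivity
    linarith
  · -- `n < N`: `M δⁿ ≥ M δ^N ≥ |R| ≥ Σ ρⁿ`
    have hδ1' : δ ^ N ≤ δ ^ n := pow_le_pow_of_le_one hδ0.le hδ1 hnN.le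
    have h2 := hsum_le' n
    have h3 := hS0 n
    have h4 : (M : ℝ) * δ ^ N ≤ M * δ ^ n := mul_le_mul_of_nonneg_left hδ1' (Nat.cast_nonneg M)
    linarith


/-! ### Standing hypotheses -/

/-- The standing hypotheses on the data of Theorem 3.2 (real simple zeros/poles) together with the choice of `M`
from Lemma 3.1: `R, S ⊂ (0,1)`, `0 < δ < 1`, and `w n ≥ 1/2` for `n ≥ 1`. [cite: BrouckeDebruyneRevesz2023, Theorem 3.2] -/
structure Adm (R S : Finset ℝ) (δ : ℝ) (M : ℕ) : Prop where
  hR : ∀ ρ ∈ R, 0 < ρ ∧ ρ < 1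
  hS : ∀ ω ∈ S, 0 < ω ∧ ω < 1
  hδ0 : 0 < δ
  hδ1 : δ < 1
  hw : ∀ n : ℕ, 1 ≤ n → 1 / 2 ≤ tmplWeight R S δ M n

/-- Lemma 3.1 supplies admissible data: for `R, S ⊂ (0,1)`, `0 < δ < 1` there is `M₀` with `Adm R S δ M` for all
`M ≥ M₀`. [cite: BrouckeDebruyneRevesz2023, Lemma 3.1] -/
theorem exists_adm (hR : ∀ ρ ∈ R, 0 < ρ ∧ ρ < 1) (hS : ∀ ω ∈ S, 0 < ω ∧ ω < 1) (hδ0 : 0 < δ) (hδ1 : δ < 1) :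
    ∃ M₀ : ℕ, ∀ M : ℕ, M₀ ≤ M → Adm R S δ M := by
  obtain ⟨M₀, hM₀⟩ := exists_forall_half_le_tmplWeight (S := S) (fun ρ hρ ↦ ⟨(hR ρ hρ).1.le, (hR ρ hρ).2⟩)
    (fun ω hω ↦ ⟨(hS ω hω).1.le, (hS ω hω).2.le⟩) hδ0 hδ1.le
  exact ⟨M₀, fun M hM ↦ ⟨hR, hS, hδ0, hδ1, hM₀ M hM⟩⟩

variable (h : Adm R S δ M)
include h

/-- `|w n| ≤ W`. [cite: BrouckeDebruyneRevesz2023, Lemma 3.1] -/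
theorem Adm.abs_tmplWeight_le (n : ℕ) : |tmplWeight R S δ M n| ≤ wBound R S M :=
  BDR.abs_tmplWeight_le (fun ρ hρ ↦ ⟨(h.hR ρ hρ).1.le, (h.hR ρ hρ).2.le⟩)
    (fun ω hω ↦ ⟨(h.hS ω hω).1.le, (h.hS ω hω).2.le⟩) h.hδ0.le h.hδ1.le n

/-- `0 ≤ w n` for `n ≥ 1`. [cite: BrouckeDebruyneRevesz2023, Lemma 3.1] -/
theorem Adm.tmplWeight_nonneg {n : ℕ} (hn : 1 ≤ n) : 0 ≤ tmplWeight R S δ M n :=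
  le_trans (by norm_num) (h.hw n hn)

omit h in
/-- `w n ≤ W`. [cite: BrouckeDebruyneRevesz2023, Lemma 3.1] -/
theorem Adm.tmplWeight_le (h : Adm R S δ M) (n : ℕ) : tmplWeight R S δ M n ≤ wBound R S M :=
  (le_abs_self _).trans (h.abs_tmplWeight_le n)

end BDR

/-! ### The coefficients of `F` and `G` -/

namespace BDR

variable (R S δ M)

/-- The coefficients of `F`: `liCoeff n · w n` (`= w n/(n ζ(n+1))`, `n ≥ 1`). [cite: BrouckeDebruyneRevesz2023, (3.1) and (2.4)] -/
def FCoeff (n : ℕ) : ℝ := liCoeff n * tmplWeight R S δ M n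

/-- The coefficients of `G`: `LiCoeff n · w n` (`= w n/n`, `n ≥ 1`). [cite: BrouckeDebruyneRevesz2023, (3.3) and (2.3)] -/
def GCoeff (n : ℕ) : ℝ := LiCoeff n * tmplWeight R S δ M n

variable {R S δ M}
variable (h : Adm R S δ M)
include h

/-- `|FCoeff n| ≤ W · 1ⁿ`. [folklore] -/
theorem Adm.abs_FCoeff_le (n : ℕ) : |FCoeff R S δ M n| ≤ wBound R S M * 1 ^ n := by
  rw [FCoeff, abs_mul, one_pow, mul_one]
  have h1 := abs_liCoeff_le n
  rw [one_mul, one_pow] at h1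
  calc |liCoeff n| * |tmplWeight R S δ M n| ≤ 1 * wBound R S M :=
        mul_le_mul h1 (h.abs_tmplWeight_le n) (abs_nonneg _) zero_le_one
    _ = wBound R S M := one_mul _

/-- `|GCoeff n| ≤ W · 1ⁿ`. [folklore] -/
theorem Adm.abs_GCoeff_le (n : ℕ) : |GCoeff R S δ M n| ≤ wBound R S M * 1 ^ n := by
  rw [GCoeff, abs_mul, one_pow, mul_one]
  have h1 := abs_LiCoeff_le n
  rw [one_mul, one_pow] at h1
  calc |LiCoeff n| * |tmplWeight R S δ M n| ≤ 1 * wBound R S M :=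
        mul_le_mul h1 (h.abs_tmplWeight_le n) (abs_nonneg _) zero_le_one
    _ = wBound R S M := one_mul _

/-- `|FCoeff (n+1)| ≤ W · 1ⁿ`. [folklore] -/
theorem Adm.abs_FCoeff_succ_le (n : ℕ) : |FCoeff R S δ M (n + 1)| ≤ wBound R S M * 1 ^ n := by
  have := h.abs_FCoeff_le (n + 1); simpa using this

/-- `|GCoeff (n+1)| ≤ W · 1ⁿ`. [folklore] -/
theorem Adm.abs_GCoeff_succ_le (n : ℕ) : |GCoeff R S δ M (n + 1)| ≤ wBound R S M * 1 ^ n := by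
  have := h.abs_GCoeff_le (n + 1); simpa using this

/-- `FCoeff n ≥ 0`. [cite: BrouckeDebruyneRevesz2023, Lemma 3.1] -/
theorem Adm.FCoeff_nonneg (n : ℕ) : 0 ≤ FCoeff R S δ M n := by
  rcases Nat.eq_zero_or_pos n with rfl | hn
  · simp [FCoeff, liCoeff]
  · exact mul_nonneg (liCoeff_nonneg n) (h.tmplWeight_nonneg hn)

/-- `GCoeff n ≥ 0`. [cite: BrouckeDebruyneRevesz2023, Lemma 3.1] -/
theorem Adm.GCoeff_nonneg (n : ℕ) : 0 ≤ GCoeff R S δ M n := by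
  rcases Nat.eq_zero_or_pos n with rfl | hn
  · simp [GCoeff, LiCoeff]
  · exact mul_nonneg (LiCoeff_nonneg n) (h.tmplWeight_nonneg hn)

/-- `FCoeff n ≤ GCoeff n` (`liCoeff ≤ LiCoeff`, `w ≥ 0`). [cite: BrouckeDebruyneRevesz2023, proof of Theorem 3.2] -/
theorem Adm.FCoeff_le_GCoeff (n : ℕ) : FCoeff R S δ M n ≤ GCoeff R S δ M n := by
  rcases Nat.eq_zero_or_pos n with rfl | hn
  · simp [FCoeff, GCoeff, liCoeff, LiCoeff]
  · exact mul_le_mul_of_nonneg_right (liCoeff_le_LiCoeff n) (h.tmplWeight_nonneg hn)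

/-- `liCoeff n / 2 ≤ FCoeff n` (`w n ≥ 1/2` for `n ≥ 1`). [cite: BrouckeDebruyneRevesz2023, Lemma 3.1] -/
theorem Adm.half_liCoeff_le_FCoeff (n : ℕ) : (1 / 2 : ℝ) * liCoeff n ≤ FCoeff R S δ M n := by
  rcases Nat.eq_zero_or_pos n with rfl | hn
  · simp [FCoeff, liCoeff]
  · rw [FCoeff, mul_comm]
    exact mul_le_mul_of_nonneg_left (h.hw n hn) (liCoeff_nonneg n)

/-- `FCoeff n ≤ W · liCoeff n`. [folklore] -/
theorem Adm.FCoeff_le (n : ℕ) : FCoeff R S δ M n ≤ wBound R S M * liCoeff n := by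
  rw [FCoeff, mul_comm]
  exact mul_le_mul_of_nonneg_right (h.tmplWeight_le n) (liCoeff_nonneg n)

/-- `GCoeff n ≤ W · LiCoeff n`. [folklore] -/
theorem Adm.GCoeff_le (n : ℕ) : GCoeff R S δ M n ≤ wBound R S M * LiCoeff n := by
  rw [GCoeff, mul_comm]
  exact mul_le_mul_of_nonneg_right (h.tmplWeight_le n) (LiCoeff_nonneg n)

/-- `GCoeff (n+1) − FCoeff (n+1) ≤ W (1/2)ⁿ` (`LiCoeff(n+1) − liCoeff(n+1) = (1 − 1/ζ(n+2))/(n+1) ≤ 2^{−n}`).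
[cite: BrouckeVindas2024, proof of Theorem 3.1] -/
theorem Adm.GCoeff_sub_FCoeff_le (n : ℕ) :
    GCoeff R S δ M (n + 1) - FCoeff R S δ M (n + 1) ≤ wBound R S M * (1 / 2 : ℝ) ^ n := by
  have hd : LiCoeff (n + 1) - liCoeff (n + 1) ≤ (1 / 2 : ℝ) ^ n := by
    have hz := zetaN_pos (by omega : 2 ≤ n + 1 + 1)
    have h1 : LiCoeff (n + 1) - liCoeff (n + 1) = (1 - (zetaN (n + 2))⁻¹) / (n + 1) := by
      simp only [LiCoeff, liCoeff, Nat.succ_ne_zero, if_false]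
      push_cast
      field_simp
    rw [h1]
    have h3 : 0 ≤ 1 - (zetaN (n + 2))⁻¹ := by
      rw [sub_nonneg]; exact inv_le_one_of_one_le₀ (one_le_zetaN (by omega))
    exact (div_le_self h3 (by linarith [(Nat.cast_nonneg n : (0:ℝ) ≤ n)])).trans (one_sub_inv_zetaN_le n)
  have hw0 : 0 ≤ tmplWeight R S δ M (n + 1) := h.tmplWeight_nonneg (by omega)
  rw [GCoeff, FCoeff, ← sub_mul]
  calc (LiCoeff (n + 1) - liCoeff (n + 1)) * tmplWeight R S δ M (n + 1)
      ≤ (1 / 2 : ℝ) ^ n * wBound R S M := mul_le_mul hd (h.tmplWeight_le _) hw0 (by positivity)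
    _ = wBound R S M * (1 / 2 : ℝ) ^ n := mul_comm _ _

end BDR

/-! ### `F`, `G` and their densities -/

namespace BDR

variable (R S δ M)

/-- **The template `F(x) = li(x) + Σ_ω li(x^ω) − Σ_ρ li(x^ρ) + M li(x^δ)`** as the log-power series with coefficients
`FCoeff` (extended by `0` on `(−∞, 1]`). [cite: BrouckeDebruyneRevesz2023, Lemma 3.1 (3.1)] -/
def F (x : ℝ) : ℝ := logSeries (FCoeff R S δ M) (Real.log (max x 1))

/-- **`G(x) = Li(x) + Σ_ω Li(x^ω) − Σ_ρ Li(x^ρ) + M Li(x^δ)`** as the log-power series with coefficients `GCoeff`.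
[cite: BrouckeDebruyneRevesz2023, proof of Theorem 3.2 (3.3)] -/
def G (x : ℝ) : ℝ := logSeries (GCoeff R S δ M) (Real.log (max x 1))

/-- The density `f = F′` on `(1, ∞)` (`0` on `(−∞, 1]`). [cite: BrouckeDebruyneRevesz2023, proof of Theorem 3.2] -/
def f (u : ℝ) : ℝ := if 1 < u then logSeries (fun n ↦ FCoeff R S δ M (n + 1)) (Real.log u) * u⁻¹ else 0

/-- The density `g = G′` on `(1, ∞)` (`0` on `(−∞, 1]`). [cite: BrouckeDebruyneRevesz2023, proof of Theorem 3.2] -/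
def g (u : ℝ) : ℝ := if 1 < u then logSeries (fun n ↦ GCoeff R S δ M (n + 1)) (Real.log u) * u⁻¹ else 0

variable {R S δ M}

/-- On `[1, ∞)`, `F x = logSeries FCoeff (log x)`. [cite: BrouckeDebruyneRevesz2023, (3.1)] -/
theorem F_eq_of_one_le {x : ℝ} (hx : 1 ≤ x) : F R S δ M x = logSeries (FCoeff R S δ M) (Real.log x) := by
  rw [F, max_eq_left hx]

/-- On `[1, ∞)`, `G x = logSeries GCoeff (log x)`. [cite: BrouckeDebruyneRevesz2023, (3.3)] -/
theorem G_eq_of_one_le {x : ℝ} (hx : 1 ≤ x) : G R S δ M x = logSeries (GCoeff R S δ M) (Real.log x) := by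
  rw [G, max_eq_left hx]

/-- `F x = 0` for `x ≤ 1`. [cite: BrouckeDebruyneRevesz2023, (3.1)] -/
theorem F_eq_zero_of_le_one {x : ℝ} (hx : x ≤ 1) : F R S δ M x = 0 := by
  rw [F, max_eq_right hx, Real.log_one, logSeries_zero]; simp [FCoeff, liCoeff]

/-- `G x = 0` for `x ≤ 1`. [cite: BrouckeDebruyneRevesz2023, (3.3)] -/
theorem G_eq_zero_of_le_one {x : ℝ} (hx : x ≤ 1) : G R S δ M x = 0 := by
  rw [G, max_eq_right hx, Real.log_one, logSeries_zero]; simp [GCoeff, LiCoeff]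

/-- `F 1 = 0`. [cite: BrouckeDebruyneRevesz2023, proof of Theorem 3.2 ("obviously satisfies `F(1) = 0`")] -/
theorem F_one : F R S δ M 1 = 0 := F_eq_zero_of_le_one le_rfl

/-- `G 1 = 0`. [cite: BrouckeDebruyneRevesz2023, (3.3)] -/
theorem G_one : G R S δ M 1 = 0 := G_eq_zero_of_le_one le_rfl

/-- `f u = 0` for `u ≤ 1`. [folklore] -/
theorem f_of_le_one {u : ℝ} (hu : u ≤ 1) : f R S δ M u = 0 := by rw [f, if_neg (not_lt.mpr hu)]

/-- `g u = 0` for `u ≤ 1`. [folklore] -/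
theorem g_of_le_one {u : ℝ} (hu : u ≤ 1) : g R S δ M u = 0 := by rw [g, if_neg (not_lt.mpr hu)]

/-- `f u` for `u > 1`. [folklore] -/
theorem f_of_one_lt {u : ℝ} (hu : 1 < u) :
    f R S δ M u = logSeries (fun n ↦ FCoeff R S δ M (n + 1)) (Real.log u) * u⁻¹ := by rw [f, if_pos hu]

/-- `g u` for `u > 1`. [folklore] -/
theorem g_of_one_lt {u : ℝ} (hu : 1 < u) :
    g R S δ M u = logSeries (fun n ↦ GCoeff R S δ M (n + 1)) (Real.log u) * u⁻¹ := by rw [g, if_pos hu]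

variable (h : Adm R S δ M)
include h

/-- `F ≥ 0`. [cite: BrouckeDebruyneRevesz2023, Lemma 3.1] -/
theorem Adm.F_nonneg (x : ℝ) : 0 ≤ F R S δ M x :=
  logSeries_nonneg h.FCoeff_nonneg (Real.log_nonneg (le_max_right x 1))

/-- `G ≥ 0`. [cite: BrouckeDebruyneRevesz2023, Lemma 3.1] -/
theorem Adm.G_nonneg (x : ℝ) : 0 ≤ G R S δ M x :=
  logSeries_nonneg h.GCoeff_nonneg (Real.log_nonneg (le_max_right x 1))

/-- **`F` is non-decreasing** (Lemma 3.1: all coefficients are non-negative). [cite: BrouckeDebruyneRevesz2023, Lemma 3.1] -/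
theorem Adm.F_mono : Monotone (F R S δ M) := fun x _ hxy ↦
  logSeries_mono wBound_pos.le h.abs_FCoeff_le h.FCoeff_nonneg (Real.log_nonneg (le_max_right x 1))
    (Real.log_le_log (lt_of_lt_of_le one_pos (le_max_right x 1)) (max_le_max hxy le_rfl))

/-- `G` is non-decreasing. [cite: BrouckeDebruyneRevesz2023, Lemma 3.1] -/
theorem Adm.G_mono : Monotone (G R S δ M) := fun x _ hxy ↦
  logSeries_mono wBound_pos.le h.abs_GCoeff_le h.GCoeff_nonneg (Real.log_nonneg (le_max_right x 1))
    (Real.log_le_log (lt_of_lt_of_le one_pos (le_max_right x 1)) (max_le_max hxy le_rfl))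

/-- `F` is continuous. [cite: BrouckeDebruyneRevesz2023, proof of Theorem 3.2 ("`F` is continuous")] -/
theorem Adm.continuous_F : Continuous (F R S δ M) :=
  (continuous_logSeries wBound_pos.le h.abs_FCoeff_le).comp
    ((continuous_id.max continuous_const).log fun x ↦ ne_of_gt (lt_of_lt_of_le one_pos (le_max_right x 1)))

/-- `G` is continuous. [cite: BrouckeDebruyneRevesz2023, proof of Theorem 3.2] -/
theorem Adm.continuous_G : Continuous (G R S δ M) :=
  (continuous_logSeries wBound_pos.le h.abs_GCoeff_le).comp
    ((continuous_id.max continuous_const).log fun x ↦ ne_of_gt (lt_of_lt_of_le one_pos (le_max_right x 1)))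

/-- `F ≤ W · li`. [cite: BrouckeDebruyneRevesz2023, proof of Theorem 3.2 (`F(x) ≪ x/log x`)] -/
theorem Adm.F_le (x : ℝ) : F R S δ M x ≤ wBound R S M * li x := by
  rw [F, li, ← logSeries_const_mul]
  refine logSeries_le_logSeries wBound_pos.le h.abs_FCoeff_le (B := wBound R S M) wBound_pos.le
    (d := fun n ↦ wBound R S M * liCoeff n) (S := 1) (fun n ↦ ?_) h.FCoeff_le (Real.log_nonneg (le_max_right x 1))
  rw [abs_mul, abs_of_pos wBound_pos]
  exact mul_le_mul_of_nonneg_left (by simpa using abs_liCoeff_le n) wBound_pos.le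

/-- `G ≤ W · Li` on `[1, ∞)`. [cite: BrouckeDebruyneRevesz2023, proof of Theorem 3.2] -/
theorem Adm.G_le {x : ℝ} (hx : 1 ≤ x) : G R S δ M x ≤ wBound R S M * Li x := by
  rw [G_eq_of_one_le hx, Li_eq_logSeries hx, ← logSeries_const_mul]
  refine logSeries_le_logSeries wBound_pos.le h.abs_GCoeff_le (B := wBound R S M) wBound_pos.le
    (d := fun n ↦ wBound R S M * LiCoeff n) (S := 1) (fun n ↦ ?_) h.GCoeff_le (Real.log_nonneg hx)
  rw [abs_mul, abs_of_pos wBound_pos]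
  exact mul_le_mul_of_nonneg_left (by simpa using abs_LiCoeff_le n) wBound_pos.le

/-- `G(x) ≤ W (x − 1)` for `x ≥ 1`. [folklore] -/
theorem Adm.G_le_sub_one {x : ℝ} (hx : 1 ≤ x) : G R S δ M x ≤ wBound R S M * (x - 1) :=
  (h.G_le hx).trans (mul_le_mul_of_nonneg_left (Li_le_sub_one hx) wBound_pos.le)

/-- `li x / 2 ≤ F x`. [cite: BrouckeDebruyneRevesz2023, Lemma 3.1] -/
theorem Adm.half_li_le_F (x : ℝ) : (1 / 2 : ℝ) * li x ≤ F R S δ M x := by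
  rw [F, li, ← logSeries_const_mul]
  refine logSeries_le_logSeries (A := 1 / 2) (R := 1) (by norm_num) (fun n ↦ ?_) wBound_pos.le h.abs_FCoeff_le
    h.half_liCoeff_le_FCoeff (Real.log_nonneg (le_max_right x 1))
  rw [abs_mul, abs_of_pos (by norm_num : (0:ℝ) < 1 / 2)]
  exact mul_le_mul_of_nonneg_left (by simpa using abs_liCoeff_le n) (by norm_num)

/-- **`F → ∞`**. [cite: BrouckeDebruyneRevesz2023, proof of Theorem 3.2] -/
theorem Adm.tendsto_F_atTop : Tendsto (F R S δ M) atTop atTop := by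
  refine tendsto_atTop_mono (fun x ↦ h.half_li_le_F x) ?_
  exact Tendsto.const_mul_atTop (by norm_num) tendsto_li_atTop

/-- **The Chebyshev bound `F(x) ≤ 2W x/log x`** for `x > 1` ("admits a bound `F(x) ≪ x/log x`").
[cite: BrouckeDebruyneRevesz2023, proof of Theorem 3.2] -/
theorem Adm.F_le_chebyshev {x : ℝ} (hx : 1 < x) : F R S δ M x ≤ 2 * wBound R S M * x / Real.log x := by
  calc F R S δ M x ≤ wBound R S M * li x := h.F_le x
    _ ≤ wBound R S M * (2 * x / Real.log x) :=
        mul_le_mul_of_nonneg_left ((li_le_Li hx.le).trans (Li_le hx)) wBound_pos.le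
    _ = 2 * wBound R S M * x / Real.log x := by ring

/-! ### The densities -/

/-- **`F′ = f` on `(1, ∞)`.** [cite: BrouckeDebruyneRevesz2023, proof of Theorem 3.2] -/
theorem Adm.hasDerivAt_F {x : ℝ} (hx : 1 < x) : HasDerivAt (F R S δ M) (f R S δ M x) x := by
  have hd := hasDerivAt_logSeries_log (c := FCoeff R S δ M) wBound_pos.le h.abs_FCoeff_le
    (ne_of_gt (lt_trans one_pos hx))
  have heq : F R S δ M =ᶠ[𝓝 x] fun y ↦ logSeries (FCoeff R S δ M) (Real.log y) := by
    filter_upwards [Ioi_mem_nhds hx] with y hy using F_eq_of_one_le (le_of_lt hy)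
  rw [f_of_one_lt hx]
  exact hd.congr_of_eventuallyEq heq

/-- **`G′ = g` on `(1, ∞)`.** [cite: BrouckeDebruyneRevesz2023, proof of Theorem 3.2] -/
theorem Adm.hasDerivAt_G {x : ℝ} (hx : 1 < x) : HasDerivAt (G R S δ M) (g R S δ M x) x := by
  have hd := hasDerivAt_logSeries_log (c := GCoeff R S δ M) wBound_pos.le h.abs_GCoeff_le
    (ne_of_gt (lt_trans one_pos hx))
  have heq : G R S δ M =ᶠ[𝓝 x] fun y ↦ logSeries (GCoeff R S δ M) (Real.log y) := by
    filter_upwards [Ioi_mem_nhds hx] with y hy using G_eq_of_one_le (le_of_lt hy)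
  rw [g_of_one_lt hx]
  exact hd.congr_of_eventuallyEq heq

omit h in
/-- `F` has derivative `f x = 0` at `x < 1`. [folklore] -/
theorem hasDerivAt_F_of_lt_one {x : ℝ} (hx : x < 1) : HasDerivAt (F R S δ M) (f R S δ M x) x := by
  rw [f_of_le_one hx.le]
  have heq : F R S δ M =ᶠ[𝓝 x] fun _ ↦ (0 : ℝ) := by
    filter_upwards [Iio_mem_nhds hx] with y hy using F_eq_zero_of_le_one (le_of_lt hy)
  exact (hasDerivAt_const x (0 : ℝ)).congr_of_eventuallyEq heq

/-- `f` is measurable. [folklore] -/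
theorem Adm.measurable_f : Measurable (f R S δ M) := by
  have h1 : Measurable fun u : ℝ ↦ logSeries (fun n ↦ FCoeff R S δ M (n + 1)) (Real.log u) * u⁻¹ :=
    ((continuous_logSeries wBound_pos.le h.abs_FCoeff_succ_le).measurable.comp Real.measurable_log).mul
      measurable_inv
  refine Measurable.ite measurableSet_Ioi h1 measurable_const

/-- `g` is measurable. [folklore] -/
theorem Adm.measurable_g : Measurable (g R S δ M) := by
  have h1 : Measurable fun u : ℝ ↦ logSeries (fun n ↦ GCoeff R S δ M (n + 1)) (Real.log u) * u⁻¹ :=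
    ((continuous_logSeries wBound_pos.le h.abs_GCoeff_succ_le).measurable.comp Real.measurable_log).mul
      measurable_inv
  refine Measurable.ite measurableSet_Ioi h1 measurable_const

/-- `f ≥ 0`. [cite: BrouckeDebruyneRevesz2023, Lemma 3.1] -/
theorem Adm.f_nonneg (u : ℝ) : 0 ≤ f R S δ M u := by
  by_cases hu : 1 < u
  · rw [f_of_one_lt hu]
    exact mul_nonneg (logSeries_nonneg (fun n ↦ h.FCoeff_nonneg _) (Real.log_nonneg hu.le))
      (inv_nonneg.mpr (by linarith))
  · rw [f, if_neg hu]

/-- **`f ≤ g`** (coefficientwise). [cite: BrouckeDebruyneRevesz2023, proof of Theorem 3.2 (monotonicity of `G − F`)] -/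
theorem Adm.f_le_g (u : ℝ) : f R S δ M u ≤ g R S δ M u := by
  by_cases hu : 1 < u
  · rw [f_of_one_lt hu, g_of_one_lt hu]
    refine mul_le_mul_of_nonneg_right ?_ (inv_nonneg.mpr (by linarith))
    exact logSeries_le_logSeries wBound_pos.le h.abs_FCoeff_succ_le wBound_pos.le h.abs_GCoeff_succ_le
      (fun n ↦ h.FCoeff_le_GCoeff _) (Real.log_nonneg hu.le)
  · rw [f, g, if_neg hu, if_neg hu]

/-- `g ≥ 0`. [cite: BrouckeDebruyneRevesz2023, Lemma 3.1] -/
theorem Adm.g_nonneg (u : ℝ) : 0 ≤ g R S δ M u := (h.f_nonneg u).trans (h.f_le_g u)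

/-- **`f ≤ W · Li′`**: `f u ≤ W (1 − 1/u)/log u` for `u > 1` (coefficientwise `FCoeff ≤ W liCoeff ≤ W LiCoeff`).
[cite: BrouckeDebruyneRevesz2023, proof of Theorem 3.2] -/
theorem Adm.f_le_mul_poleDensity {u : ℝ} (hu : 1 < u) : f R S δ M u ≤ wBound R S M * DMV.poleDensity u := by
  rw [f_of_one_lt hu, poleDensity_eq_logSeries hu, ← mul_assoc, ← logSeries_const_mul]
  refine mul_le_mul_of_nonneg_right ?_ (inv_nonneg.mpr (by linarith))
  refine logSeries_le_logSeries wBound_pos.le h.abs_FCoeff_succ_le (B := wBound R S M) wBound_pos.le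
    (d := fun n ↦ wBound R S M * LiCoeff (n + 1)) (S := 1) (fun n ↦ ?_) (fun n ↦ ?_) (Real.log_nonneg hu.le)
  · rw [abs_mul, abs_of_pos wBound_pos]
    exact mul_le_mul_of_nonneg_left (by simpa using abs_LiCoeff_succ_le n) wBound_pos.le
  · exact (h.FCoeff_le _).trans (mul_le_mul_of_nonneg_left (liCoeff_le_LiCoeff _) wBound_pos.le)

/-- `g ≤ W · Li′` for `u > 1`. [cite: BrouckeDebruyneRevesz2023, proof of Theorem 3.2] -/
theorem Adm.g_le_mul_poleDensity {u : ℝ} (hu : 1 < u) : g R S δ M u ≤ wBound R S M * DMV.poleDensity u := by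
  rw [g_of_one_lt hu, poleDensity_eq_logSeries hu, ← mul_assoc, ← logSeries_const_mul]
  refine mul_le_mul_of_nonneg_right ?_ (inv_nonneg.mpr (by linarith))
  refine logSeries_le_logSeries wBound_pos.le h.abs_GCoeff_succ_le (B := wBound R S M) wBound_pos.le
    (d := fun n ↦ wBound R S M * LiCoeff (n + 1)) (S := 1) (fun n ↦ ?_) (fun n ↦ h.GCoeff_le _)
    (Real.log_nonneg hu.le)
  rw [abs_mul, abs_of_pos wBound_pos]
  exact mul_le_mul_of_nonneg_left (by simpa using abs_LiCoeff_succ_le n) wBound_pos.le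

/-- **`f ≤ W`**. [cite: BrouckeDebruyneRevesz2023, proof of Theorem 3.2] -/
theorem Adm.f_le_wBound (u : ℝ) : f R S δ M u ≤ wBound R S M := by
  by_cases hu : 1 < u
  · calc f R S δ M u ≤ wBound R S M * DMV.poleDensity u := h.f_le_mul_poleDensity hu
      _ ≤ wBound R S M * 1 := mul_le_mul_of_nonneg_left (poleDensity_le_one hu) wBound_pos.le
      _ = wBound R S M := mul_one _
  · rw [f, if_neg hu]; exact wBound_pos.le

/-- `g ≤ W`. [cite: BrouckeDebruyneRevesz2023, proof of Theorem 3.2] -/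
theorem Adm.g_le_wBound (u : ℝ) : g R S δ M u ≤ wBound R S M := by
  by_cases hu : 1 < u
  · calc g R S δ M u ≤ wBound R S M * DMV.poleDensity u := h.g_le_mul_poleDensity hu
      _ ≤ wBound R S M * 1 := mul_le_mul_of_nonneg_left (poleDensity_le_one hu) wBound_pos.le
      _ = wBound R S M := mul_one _
  · rw [g, if_neg hu]; exact wBound_pos.le

/-- `|f| ≤ W` on `(1, ∞)` (the form consumed by `BV`). [folklore] -/
theorem Adm.abs_f_le (u : ℝ) : |f R S δ M u| ≤ wBound R S M := by
  rw [abs_of_nonneg (h.f_nonneg u)]; exact h.f_le_wBound u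

/-- **`f u ≤ W/log u`** for `u > 1` (`(1 − 1/u)/log u ≤ 1/log u`): `f ≤ 2` as soon as `log u ≥ W/2`.
[cite: BrouckeDebruyneRevesz2023, proof of Theorem 3.2] -/
theorem Adm.f_le_div_log {u : ℝ} (hu : 1 < u) : f R S δ M u ≤ wBound R S M / Real.log u := by
  have hL : 0 < Real.log u := Real.log_pos hu
  refine (h.f_le_mul_poleDensity hu).trans ?_
  rw [div_eq_mul_one_div]
  refine mul_le_mul_of_nonneg_left ?_ wBound_pos.le
  unfold DMV.poleDensity
  refine div_le_div_of_nonneg_right ?_ hL.le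
  have : 0 < 1 / u := by positivity
  linarith

/-- **`g − f ≤ W u^{−1/2}`** for `u > 1` (coefficientwise `≤ W 2^{−n}`, and `Σ (log u/2)ⁿ/n! = √u`).
[cite: BrouckeVindas2024, proof of Theorem 3.1] -/
theorem Adm.g_sub_f_le {u : ℝ} (hu : 1 < u) : g R S δ M u - f R S δ M u ≤ wBound R S M * u ^ (-(1 / 2 : ℝ)) := by
  have hu0 : 0 < u := lt_trans one_pos hu
  have hL : 0 ≤ Real.log u := Real.log_nonneg hu.le
  set d : ℕ → ℝ := fun n ↦ GCoeff R S δ M (n + 1) - FCoeff R S δ M (n + 1) with hd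
  have hd0 : ∀ n, 0 ≤ d n := fun n ↦ by simp only [hd]; linarith [h.FCoeff_le_GCoeff (n + 1)]
  have hdle : ∀ n, d n ≤ wBound R S M * (1 / 2 : ℝ) ^ n := fun n ↦ h.GCoeff_sub_FCoeff_le n
  have hdabs : ∀ n, |d n| ≤ wBound R S M * 1 ^ n := fun n ↦ by
    rw [abs_of_nonneg (hd0 n), one_pow, mul_one]
    exact (hdle n).trans (mul_le_of_le_one_right wBound_pos.le (pow_le_one₀ (by norm_num) (by norm_num)))
  have hhalf : ∀ n, |wBound R S M * (1 / 2 : ℝ) ^ n| ≤ wBound R S M * (1 / 2) ^ n := fun n ↦ by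
    rw [abs_of_nonneg (by have := wBound_pos (R := R) (S := S) (M := M); positivity)]
  have hdiff : g R S δ M u - f R S δ M u = logSeries d (Real.log u) * u⁻¹ := by
    rw [g_of_one_lt hu, f_of_one_lt hu, ← sub_mul]
    congr 1
    have hadd := logSeries_add wBound_pos.le hdabs wBound_pos.le h.abs_FCoeff_succ_le (Real.log u)
    have : (fun n ↦ d n + FCoeff R S δ M (n + 1)) = fun n ↦ GCoeff R S δ M (n + 1) := by
      funext n; simp only [hd]; ring
    rw [this] at hadd
    linarith
  rw [hdiff]
  have hle : logSeries d (Real.log u) ≤ logSeries (fun n ↦ wBound R S M * (1 / 2 : ℝ) ^ n) (Real.log u) :=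
    logSeries_le_logSeries wBound_pos.le hdabs wBound_pos.le hhalf hdle hL
  rw [logSeries_const_mul, logSeries_pow] at hle
  have hsqrt : Real.exp (1 / 2 * Real.log u) = u ^ (1 / 2 : ℝ) := by
    rw [Real.rpow_def_of_pos hu0, mul_comm]
  rw [hsqrt] at hle
  calc logSeries d (Real.log u) * u⁻¹ ≤ wBound R S M * u ^ (1 / 2 : ℝ) * u⁻¹ :=
        mul_le_mul_of_nonneg_right hle (inv_nonneg.mpr hu0.le)
    _ = wBound R S M * u ^ (-(1 / 2 : ℝ)) := by
        rw [mul_assoc, ← Real.rpow_neg_one, ← Real.rpow_add hu0]; norm_num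

/-- The pair `(f, g)` in the form consumed by `BV` (`0 ≤ g − f ≤ W u^{−1/2}` on `(1, ∞)`).
[cite: BrouckeVindas2024, proof of Theorem 3.1] -/
theorem Adm.g_sub_f_mem (u : ℝ) (hu : 1 < u) :
    0 ≤ g R S δ M u - f R S δ M u ∧ g R S δ M u - f R S δ M u ≤ wBound R S M * u ^ (-(1 / 2 : ℝ)) :=
  ⟨by linarith [h.f_le_g u], h.g_sub_f_le hu⟩


end BDR

/-! ### `g` in terms of the densities `cpowDensity r = d/du Li(u^r)` -/

namespace BDR

/-- `Σ_{n≥0} r^{n+1} Lⁿ/((n+1) n!) = (u^r − 1)/log u` at `L = log u`, `u > 1` (`x log x · (d/dx)Li(x^r) = x^r − 1`,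
BDR (2.5)). [cite: BrouckeDebruyneRevesz2023, §2 (2.5)] -/
theorem hasSum_LiCoeff_pow {u : ℝ} (hu : 1 < u) (r : ℝ) :
    HasSum (fun n : ℕ ↦ LiCoeff (n + 1) * r ^ (n + 1) * Real.log u ^ n / n !) ((u ^ r - 1) / Real.log u) := by
  have hL : 0 < Real.log u := Real.log_pos hu
  have hu0 : 0 < u := lt_trans one_pos hu
  have h1 := mul_logSeries_pow_succ_div r (Real.log u)
  rw [show Real.exp (r * Real.log u) = u ^ r by rw [Real.rpow_def_of_pos hu0, mul_comm]] at h1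
  have hval : logSeries (fun n ↦ r ^ (n + 1) / (n + 1)) (Real.log u) = (u ^ r - 1) / Real.log u := by
    rw [eq_div_iff hL.ne', mul_comm]
    exact h1
  have hc : ∀ n : ℕ, |r ^ (n + 1) / ((n : ℝ) + 1)| ≤ |r| * |r| ^ n := by
    intro n
    have hn : (1 : ℝ) ≤ (n : ℝ) + 1 := by linarith [(n.cast_nonneg : (0:ℝ) ≤ n)]
    rw [abs_div, abs_pow, pow_succ, abs_of_pos (by positivity : (0 : ℝ) < n + 1)]
    calc |r| ^ n * |r| / ((n : ℝ) + 1) ≤ |r| ^ n * |r| := div_le_self (by positivity) hn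
      _ = |r| * |r| ^ n := mul_comm _ _
  have hs := hasSum_logSeries (abs_nonneg r) hc (Real.log u)
  rw [hval] at hs
  refine hs.congr_fun fun n ↦ ?_
  simp only [LiCoeff, Nat.succ_ne_zero, if_false]
  push_cast
  ring

/-- For real `r` and `u > 0`: `cpowDensity r u = ((u^r − 1)/log u) · u⁻¹` (a real number).
[cite: BrouckeDebruyneRevesz2023, §2 (2.3)] -/
theorem cpowDensity_ofReal {u : ℝ} (hu : 0 < u) (r : ℝ) :
    cpowDensity r u = (((u ^ r - 1) / Real.log u * u⁻¹ : ℝ) : ℂ) := by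
  unfold cpowDensity
  have h1 : (u : ℂ) ^ ((r : ℂ) - 1) = ((u ^ (r - 1) : ℝ) : ℂ) := by
    rw [Complex.ofReal_cpow hu.le]; push_cast; ring_nf
  rw [h1, Real.rpow_sub_one hu.ne']
  push_cast
  field_simp

variable {R S : Finset ℝ} {δ : ℝ} {M : ℕ}

/-- **`g = Li′ + Σ_ω (Li(u^ω))′ − Σ_ρ (Li(u^ρ))′ + M (Li(u^δ))′`**: for `u > 1`,
`g(u) = cpowDensity 1 u + Σ_{ω∈S} cpowDensity ω u − Σ_{ρ∈R} cpowDensity ρ u + M · cpowDensity δ u`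
(no hypothesis on the data is needed: a finite combination of convergent series).
[cite: BrouckeDebruyneRevesz2023, proof of Theorem 3.2 (3.3)] -/
theorem g_eq_cpowDensity {u : ℝ} (hu : 1 < u) :
    (g R S δ M u : ℂ) = cpowDensity (1 : ℝ) u + ∑ ω ∈ S, cpowDensity (ω : ℝ) u - ∑ ρ ∈ R, cpowDensity (ρ : ℝ) u +
      (M : ℂ) * cpowDensity (δ : ℝ) u := by
  have hu0 : 0 < u := lt_trans one_pos hu
  set L := Real.log u with hLdef
  set v : ℝ → ℝ := fun r ↦ (u ^ r - 1) / Real.log u with hv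
  -- the series of `g u · u` as a combination of the `hasSum_LiCoeff_pow`
  have hterm : ∀ n : ℕ, GCoeff R S δ M (n + 1) * L ^ n / (n ! : ℝ) =
      LiCoeff (n + 1) * (1 : ℝ) ^ (n + 1) * L ^ n / (n ! : ℝ) +
        (∑ ω ∈ S, LiCoeff (n + 1) * ω ^ (n + 1) * L ^ n / (n ! : ℝ)) -
        (∑ ρ ∈ R, LiCoeff (n + 1) * ρ ^ (n + 1) * L ^ n / (n ! : ℝ)) +
        (M : ℝ) * (LiCoeff (n + 1) * δ ^ (n + 1) * L ^ n / (n ! : ℝ)) := by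
    intro n
    simp only [GCoeff, tmplWeight, one_pow, mul_one, ← Finset.sum_div, ← Finset.sum_mul, ← Finset.mul_sum]
    ring
  have hsum : HasSum (fun n : ℕ ↦ GCoeff R S δ M (n + 1) * L ^ n / n !)
      (v 1 + ∑ ω ∈ S, v ω - ∑ ρ ∈ R, v ρ + (M : ℝ) * v δ) := by
    simp_rw [hterm]
    refine (((hasSum_LiCoeff_pow hu 1).add (hasSum_sum fun ω _ ↦ hasSum_LiCoeff_pow hu ω)).sub
      (hasSum_sum fun ρ _ ↦ hasSum_LiCoeff_pow hu ρ)).add ((hasSum_LiCoeff_pow hu δ).mul_left (M : ℝ))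
  have hg : g R S δ M u = (v 1 + ∑ ω ∈ S, v ω - ∑ ρ ∈ R, v ρ + (M : ℝ) * v δ) * u⁻¹ := by
    rw [g_of_one_lt hu, logSeries, hsum.tsum_eq]
  rw [hg]
  simp only [cpowDensity_ofReal hu0, hv]
  push_cast
  simp only [Finset.sum_mul, add_mul, sub_mul]
  ring

end BDR

/-! ### `Σ_{k≥1} F(x^{1/k})/k = G(x)` -/

namespace BDR

variable {R S : Finset ℝ} {δ : ℝ} {M : ℕ}

/-- `F(x^{1/(k+1)}) = logSeries FCoeff (log x/(k+1))` for `x ≥ 1`. [cite: BrouckeDebruyneRevesz2023, proof of Theorem 3.2] -/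
theorem F_rpow_eq {x : ℝ} (hx : 1 ≤ x) (k : ℕ) :
    F R S δ M (x ^ (1 / ((k : ℝ) + 1))) = logSeries (FCoeff R S δ M) (Real.log x / (k + 1)) := by
  have hx0 : 0 < x := lt_of_lt_of_le one_pos hx
  have h1 : 1 ≤ x ^ (1 / ((k : ℝ) + 1)) := Real.one_le_rpow hx (by positivity)
  rw [F_eq_of_one_le h1, Real.log_rpow hx0]
  congr 1
  field_simp

/-- **`Σ_{k≥1} F(x^{1/k})/k = G(x)`** for `x ≥ 1` (BDR (3.3): "`G(x) := Σ_k F(x^{1/k})/k = Li(x) + Σ_ω Li(x^ω) − …`,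
in view of `Li(x) = Σ_k li(x^{1/k})/k`"), by rearranging the non-negative double series
`Σ_k Σ_n FCoeff n (log x)ⁿ (k+1)^{−(n+1)}/n! = Σ_n FCoeff n ζ(n+1) (log x)ⁿ/n! = Σ_n GCoeff n (log x)ⁿ/n!`.
[cite: BrouckeDebruyneRevesz2023, proof of Theorem 3.2 (3.3)] -/
theorem Adm.hasSum_F_rpow_div (h : Adm R S δ M) {x : ℝ} (hx : 1 ≤ x) :
    HasSum (fun k : ℕ ↦ F R S δ M (x ^ (1 / ((k : ℝ) + 1))) / (k + 1)) (G R S δ M x) := by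
  -- the double family `D n k = FCoeff n Lⁿ/n! · (k+1)^{−(n+1)}`, `L = log x`
  set D : ℕ → ℕ → ℝ := fun n k ↦ FCoeff R S δ M n * Real.log x ^ n / n ! * (1 / ((k + 1 : ℕ) : ℝ) ^ (n + 1))
    with hD
  have hL : 0 ≤ Real.log x := Real.log_nonneg hx
  have hD0 : ∀ n k, 0 ≤ D n k := fun n k ↦ by
    have := h.FCoeff_nonneg n; simp only [hD]; positivity
  -- inner sums over `k`: `Σ_k D n k = GCoeff n Lⁿ/n!`
  have hinner : ∀ n, HasSum (fun k ↦ D n k) (GCoeff R S δ M n * Real.log x ^ n / n !) := by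
    intro n
    rcases Nat.eq_zero_or_pos n with rfl | hn
    · have h0 : (fun k ↦ D 0 k) = fun _ ↦ 0 := by funext k; simp [hD, FCoeff, liCoeff]
      rw [h0]; simp [GCoeff, LiCoeff, hasSum_zero]
    · have hs := summable_one_div_succ_pow (by omega : 2 ≤ n + 1)
      have h1 := (hs.hasSum).mul_left (FCoeff R S δ M n * Real.log x ^ n / n !)
      have hval : FCoeff R S δ M n * Real.log x ^ n / n ! * zetaN (n + 1) = GCoeff R S δ M n * Real.log x ^ n / n ! := by
        rw [GCoeff, ← liCoeff_mul_zetaN n, FCoeff]; ring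
      rw [zetaN] at hval
      rw [← hval]
      exact h1
  have hsumm_n : Summable fun n ↦ GCoeff R S δ M n * Real.log x ^ n / n ! :=
    summable_logSeries wBound_pos.le h.abs_GCoeff_le (Real.log x)
  have hDs : Summable (Function.uncurry D) := by
    refine (summable_prod_of_nonneg fun p ↦ hD0 p.1 p.2).mpr ⟨fun n ↦ (hinner n).summable, ?_⟩
    exact hsumm_n.congr fun n ↦ ((hinner n).tsum_eq).symm
  have hDval : HasSum (Function.uncurry D) (G R S δ M x) := by
    have h1 : ∑' p, Function.uncurry D p = ∑' n, ∑' k, D n k := hDs.tsum_prod' fun n ↦ (hinner n).summable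
    have h2 : ∑' n, ∑' k, D n k = logSeries (GCoeff R S δ M) (Real.log x) := by
      rw [logSeries]; exact tsum_congr fun n ↦ (hinner n).tsum_eq
    rw [G_eq_of_one_le hx, ← h2, ← h1]
    exact hDs.hasSum
  -- swap the order of summation and identify the fibres over `k`
  have hswap : HasSum ((Function.uncurry D) ∘ (Equiv.prodComm ℕ ℕ)) (G R S δ M x) :=
    (Equiv.prodComm ℕ ℕ).hasSum_iff.mpr hDval
  refine hswap.prod_fiberwise fun k ↦ ?_
  have hk : (0 : ℝ) < (k : ℝ) + 1 := by positivity
  have h := (hasSum_logSeries wBound_pos.le h.abs_FCoeff_le (Real.log x / (k + 1))).div_const ((k : ℝ) + 1)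
  rw [← F_rpow_eq hx k] at h
  have hfun : ∀ n, (Function.uncurry D ∘ (Equiv.prodComm ℕ ℕ)) (k, n) =
      FCoeff R S δ M n * (Real.log x / (k + 1)) ^ n / n ! / (k + 1) := by
    intro n
    simp only [Function.comp_apply, Equiv.prodComm_apply, Prod.swap_prod_mk, Function.uncurry_apply_pair, hD]
    push_cast
    rw [div_pow]
    field_simp
    ring
  simp_rw [hfun]
  exact h

end BDR

end Literature.NumberTheory.BeurlingPrimes
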